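import Literature.MathematicalPhysics.QuantumFieldTheory.Balaban1983to89.B8Thm4Concrete

/-!
# `Balaban1983to89.B8Thm4ConcreteAt` — [Balaban1985RegularSpaces] THEOREM 4 (p. 88) IN THE LEAF'S QUANTIFIER SHAPE ON THE CONCRETE `ℤᵈ`
# CARRIERS, WITH THE FOUR SOCKETS TAKEN **AT THE DATUM** `(U₀, U′U₀)` — the per-datum form of `B8Thm4Concrete.thm4Body_concrete_guarded`

statement-level skeleton of published theorems with citation tags; proofs where landed; nothing here is a claim about the
Yang–Mills mass gap

T. Bałaban, *Spaces of regular gauge field configurations on a lattice and gauge fixing conditions*, Commun. Math. Phys. **99**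
(1985) 75–102 `[Balaban1985RegularSpaces]` ("B8"), Theorem 4 p. 88, Proposition 5 pp. 93–94, (1.59) p. 86.

CITATION HEADER (lean-in-tree rule).  Cell `pub-ymgap` (YM Track A, HUMAN RULING D-0062), DAG node N05 = [B8], seat `pub-ymgap-dag-n05-c`
(R134 fan-out; FAN-OUT v1.1 §N05 row s3b).  WHAT IS REPRODUCED: n05-a's `B8Thm4Concrete.thm4Body_concrete_guarded` (p422643/p423286) VERBATIM
IN CONTENT, with ONE change of quantifier placement: there, each of the four sockets (Prop. 5 ∃ base ∕ ∃ step, [4] Thm 3.3 = (1.59), Prop. 5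
uniqueness) is a hypothesis quantified over ALL data `(α₀, α₁, U₀, U′)` below a providers' threshold `cP`; its proof uses each socket ONCE, at
the datum of the conclusion.  HERE the sockets are asked only AT THAT DATUM (after `∀ α₀ α₁ … ∀ U₀ U′ …` and the datum's (1.33)∕(1.34)∕(1.35)∕
(1.66)₀ hypotheses), and the providers' threshold `cP` disappears.  Proof = n05-a's, with the four socket applications replaced by the
hypotheses (adapted from `B8Thm4Concrete.lean` ll. 260–450; windows `B8Thm4Windows`, existence `B8Thm4SupportLocal.thm4_exists_all_levels_supp_landau138`,
`B8Prop3GaugeFixedKLevel.logField_spec`, uniqueness `B8Thm4SupportLocal.thm4_unique_eq_landau138`).  Kind «kernel-checked proof», ONE theorem.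

WHY (located): a consumer that applies Theorem 4 at ONE background — print's Proposition 6, p. 99, «the assumptions of Theorem 4 are satisfied
for the pair of configurations 1, U₀″» (`B8Prop6CubeMember`) — needs the sockets at the FLAT background `U₀ = 1` only, where their letters are
the flat operators of [B5]∕[4] (cf. `B8Ineq192MultiLevelBox`, `B8Ineq198MultiLevelBox`, `B6Prop23MultiLevelBox`); the `∀ U₀`-sockets of the
guarded form would ask them at every curved background of the member.  `thm4Body_concrete_guarded` is the special case «sockets uniform in
the datum» (not restated).

HONEST SCOPE.  Nothing new of Bałaban's is proved; the sockets remain hypotheses (now per datum); count-neutral; N05 NOT discharged; `T_η ↦ ℤᵈ`;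
nothing continuum ∕ ℝ⁴ ∕ OS ∕ mass-gap ∕ Clay.  Unit `pub-ymgap-dag-n05-c` (g0), 2026-08-26.
-/

noncomputable section

open NormedSpace

namespace Literature.MathematicalPhysics.QuantumFieldTheory.Balaban1983to89.B8Thm4ConcreteAt

open Complex (I)
open MatrixLog B7Prop1Explicit B7Prop2Explicit B7Prop1Local B7Eq92Concrete
open B7Prop2Explicit (C0 c2')
open B7Prop3Flat (c3)
open B8Ineq132 (covDerivFwd InAk)
open B8Eq119TwistedAxial (Restr129 InAx)
open B8Eq184Proof (gaugeExp cfgExp)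
open B8Lemma1NonAbelian (mulCfg)
open B8Eq140Level (SideTouches)
open B8Eq146AExpansion (iEta)
open B7Prop4GeneralLevels (logCovIter linCovIter)
open B8Eq155JBound (Jcur wsup)
open B8ScaledSupNorm (bondNorm msup)
open B8Thm2LogB (blockTop)
open B8Ineq130 (tlo thi)
open B8Eq138LandauZd (IsLandau138W logCfg)
open B8Prop3GaugeFixedKLevel (eq_mgauge_inv_of_mgauge_eq mem_unitaryUnits_of_mgauge_eq logField_spec)
open B8Thm4SupportLocal (thm4_exists_all_levels_supp_landau138 thm4_unique_eq_landau138)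
open B8Thm4Windows (thm4_windows thm4_windows_extra)
open B8Thm4Concrete (mulCfg_eq_mul)

export B7Prop1Explicit (Site)

variable {d : ℕ}

variable {𝔸 : Type*} [CStarAlgebra 𝔸] [Nontrivial 𝔸]

/-- **THEOREM 4 IN THE LEAF'S QUANTIFIER SHAPE, SOCKETS AT THE DATUM** — `B8Thm4Concrete.thm4Body_concrete_guarded` with the Proposition-5
sockets (∃ base `v, λ` at the datum «u₁ = 1, U′»; ∃ step at every intermediate `(u₁, U₁)` over THIS `(U₀, U′)`), the (1.59) socket ([4] Thm 3.3
in Prop. 3's frame, for fields `W` gauge-related to THIS `U′` over THIS `U₀`) and Proposition 5's uniqueness (1.109) (for competitors over THIS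
datum) asked AFTER the datum is fixed: ONE threshold `c₁(d, L, B₀, B₀′, cu) > 0` chosen BEFORE the member data `(η, k, {Ω_j}, Λs, Λb)` (as in
`thm4Body_concrete_uniform`); for `α₀ + α₁ ≤ c₁` and a unitary datum `(U₀, U′)` with (1.33),
(1.34) (+ block axial gauge at every truncation), (1.35) on the boxes, (1.66)₀, IF the four socket bodies hold at this datum THEN there is a
unitary `u`, `= 1` off `Ω₀`, with (1.29), (1.38) of record, the (1.62)-shape `|A| ≤ 5dLB₀(α₀ + α₁)(Lʲη)⁻¹`, unique among such.
[cite: Balaban1985RegularSpaces, Thm 4 p.88, (1.29) p.81, (1.38) p.82, (1.62) p.87, Prop. 5 (1.108)–(1.109) p.94, (1.59) p.86, pp.94–95] -/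
theorem thm4Body_concrete_at (hd2 : 2 ≤ d) {L : ℕ} (hL : 2 ≤ L)
    {B₀ B₀' cu : ℝ} (hB₀ : 0 < B₀) (hB₀' : 0 < B₀') (hB : 2 ≤ 5 * (d : ℝ) * L * B₀) (hcu : 0 < cu) :
    ∃ c₁ : ℝ, 0 < c₁ ∧ ∀ (η : ℝ), 0 < η → ∀ (k : ℕ)
    (Ω : ℕ → Set (Site d)) (hΩ : ∀ j, Ω (j + 1) ⊆ Ω j) (Λs : ℕ → ℕ → Set (Site d)) (Λb : ℕ → ℕ → Set (Site d × Fin d))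
    (hbox : ∀ m, m ≤ k → ∀ j, j ≤ m → ∀ c ∈ Λb m j, ∀ x, InBox (loK L j c.1) (bondHiK L j c.1 c.2) x → x ∈ Ω j)
    (hclass : ∀ m, m ≤ k → ∀ j, j ≤ m → ∀ c ∈ Λb m j,
      (c.1 ∈ Λs m j ∧ c.1 + e c.2 ∈ Λs m j) ∨
      (∃ j', j = j' + 1 ∧ (∀ x, (L : ℤ) • c.1 ≤ x → x ≤ (L : ℤ) • c.1 + blockTop L → x ∈ Λs m j') ∧ c.1 + e c.2 ∈ Λs m j) ∨
      (∃ j', j = j' + 1 ∧ c.1 ∈ Λs m j ∧ (∀ x, (L : ℤ) • (c.1 + e c.2) ≤ x → x ≤ (L : ℤ) • (c.1 + e c.2) + blockTop L → x ∈ Λs m j')))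
    (htower : ∀ j, j ≤ k → ∀ y ∈ Λs k j, ∀ x, InBox (tlo L y j) (thi L y j) x → x ∈ Ω j)
    (hpart : ∀ x, x ∈ Ω 0 → ∃ j, j ≤ k ∧ ∃ y ∈ Λs k j, InBox (tlo L y j) (thi L y j) x),
      ∀ α₀ α₁ : ℝ, 0 < α₀ → 0 < α₁ → α₀ + α₁ ≤ c₁ →
      ∀ U₀ U' : Site d → Fin d → 𝔸ˣ, (∀ x κ, U₀ x κ ∈ unitaryUnits 𝔸) → (∀ x κ, U' x κ ∈ unitaryUnits 𝔸) →
      InAk L k η α₀ Ω U₀ → InAk L k η α₀ Ω (mulCfg U' U₀) → (∀ m, m ≤ k → InAx L m (Λs m) U₀ (mulCfg U' U₀)) →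
      (∀ j, j ≤ k → ∀ (z : Site d) (μ : Fin d), (∀ x, InBox (loK L j z) (bondHiK L j z μ) x → x ∈ Ω j) →
        ‖(avgIter L (mulCfg U' U₀) j z μ : 𝔸) - (avgIter L U₀ j z μ : 𝔸)‖ ≤ α₁) →
      (∀ b ∈ {b : Site d × Fin d | SideTouches (Ω 0) b.1 b.2}, ‖((U' b.1 b.2 : 𝔸ˣ) : 𝔸) - 1‖ ≤ α₁) →
      ((∃ (v : Site d → 𝔸ˣ) (lam : Site d → 𝔸), (∀ x, v x ∈ unitaryUnits 𝔸) ∧ (∀ x, x ∉ Ω 0 → v x = 1) ∧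
        (∀ j, j ≤ 1 → ∀ b ∈ {b : Site d × Fin d | SideTouches (Ω j) b.1 b.2}, (v b.1 : 𝔸) = ((gaugeExp lam b.1 : 𝔸ˣ) : 𝔸) ∧
        (v (b.1 + e b.2) : 𝔸) = ((gaugeExp lam (b.1 + e b.2) : 𝔸ˣ) : 𝔸)) ∧
        (∀ j, j ≤ 1 → ∀ b ∈ {b : Site d × Fin d | SideTouches (Ω j) b.1 b.2},
        ‖lam b.1‖ ≤ (8 * B₀' * (5 * (d : ℝ) * L * B₀) * (α₀ + α₁)) ∧ ((L : ℝ) ^ j * η) * ‖covDerivFwd η U₀ b.2 lam b.1‖ ≤ (8 * B₀' * (5 * (d : ℝ) * L * B₀) * (α₀ + α₁))) ∧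
        IsLandau138W L 1 η (Ω 0) (Λs 1) U₀ (mgauge U₀ v⁻¹ U') ∧ Restr129 L 1 (Λs 1) U₀ ((1 : Site d → 𝔸ˣ) * v))) →
      ((∀ m, 1 ≤ m → m < k → ∀ (u₁ : Site d → 𝔸ˣ) (U₁ : Site d → Fin d → 𝔸ˣ) (A : Site d → Fin d → 𝔸),
        (∀ x, u₁ x ∈ unitaryUnits 𝔸) → (∀ x, x ∉ Ω 0 → u₁ x = 1) → mgauge U₀ u₁ U₁ = U' → Restr129 L m (Λs m) U₀ u₁ →
        IsLandau138W L m η (Ω 0) (Λs m) U₀ U₁ →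
        (∀ j, j ≤ m → ∀ b ∈ {b : Site d × Fin d | SideTouches (Ω j) b.1 b.2},
        U₁ b.1 b.2 = cfgExp η A b.1 b.2 ∧ IsSelfAdjoint (A b.1 b.2) ∧ ‖A b.1 b.2‖ ≤ (5 * (d : ℝ) * L * B₀ * (α₀ + α₁)) * ((L : ℝ) ^ j * η)⁻¹) →
        ∃ (v : Site d → 𝔸ˣ) (lam : Site d → 𝔸), (∀ x, v x ∈ unitaryUnits 𝔸) ∧ (∀ x, x ∉ Ω 0 → v x = 1) ∧
        (∀ j, j ≤ m + 1 → ∀ b ∈ {b : Site d × Fin d | SideTouches (Ω j) b.1 b.2}, (v b.1 : 𝔸) = ((gaugeExp lam b.1 : 𝔸ˣ) : 𝔸) ∧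
        (v (b.1 + e b.2) : 𝔸) = ((gaugeExp lam (b.1 + e b.2) : 𝔸ˣ) : 𝔸)) ∧
        (∀ j, j ≤ m + 1 → ∀ b ∈ {b : Site d × Fin d | SideTouches (Ω j) b.1 b.2},
        ‖lam b.1‖ ≤ (8 * B₀' * (5 * (d : ℝ) * L * B₀) * (α₀ + α₁)) ∧ ((L : ℝ) ^ j * η) * ‖covDerivFwd η U₀ b.2 lam b.1‖ ≤ (8 * B₀' * (5 * (d : ℝ) * L * B₀) * (α₀ + α₁))) ∧
        IsLandau138W L (m + 1) η (Ω 0) (Λs (m + 1)) U₀ (mgauge U₀ v⁻¹ U₁) ∧ Restr129 L (m + 1) (Λs (m + 1)) U₀ (u₁ * v))) →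
      ((∀ m, 1 ≤ m → m ≤ k → ∀ (u : Site d → 𝔸ˣ) (W : Site d → Fin d → 𝔸ˣ) (A' : Site d → Fin d → 𝔸),
        (∀ x, u x ∈ unitaryUnits 𝔸) → mgauge U₀ u W = U' → Restr129 L m (Λs m) U₀ u → IsLandau138W L m η (Ω 0) (Λs m) U₀ W →
        (∀ y τ, IsSelfAdjoint (A' y τ)) →
        (∀ j, j ≤ m → ∀ y τ, SideTouches (Ω j) y τ →
        W y τ = cfgExp η A' y τ ∧ ‖A' y τ‖ ≤ (2 * (L * (5 * (d : ℝ) * L * B₀ * (α₀ + α₁))) + 8 * (8 * B₀' * (5 * (d : ℝ) * L * B₀) * (α₀ + α₁))) * ((L : ℝ) ^ j * η)⁻¹) →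
        (∀ y τ, (∀ j, j ≤ m → ¬ SideTouches (Ω j) y τ) → A' y τ = 0) →
        msup L m η (-(1 : ℝ)) (fun j (b : Site d × Fin d) => SideTouches (Ω j) b.1 b.2) (fun b => A' b.1 b.2)
        ≤ B₀ * (bondNorm L m η (-(3 : ℝ)) Ω (fun x μ => Jcur η U₀ A' μ x)
        + wsup 1 (fun p : {p : ℕ × (Site d × Fin d) // p.1 ≤ m ∧ p.2 ∈ Λb m p.1} =>
        linCovIter L U₀ (iEta η A') p.1.1 p.1.2.1 p.1.2.2)) ∧
        msup L m η (-(2 : ℝ)) (fun j (t : Fin d × Fin d × Site d) => SideTouches (Ω j) t.2.2 t.2.1)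
        (fun t => covDerivFwd η U₀ t.1 (fun z => A' z t.2.1) t.2.2)
        ≤ B₀ * (bondNorm L m η (-(3 : ℝ)) Ω (fun x μ => Jcur η U₀ A' μ x)
        + wsup 1 (fun p : {p : ℕ × (Site d × Fin d) // p.1 ≤ m ∧ p.2 ∈ Λb m p.1} =>
        linCovIter L U₀ (iEta η A') p.1.1 p.1.2.1 p.1.2.2)))) →
      (∀ u₁ : Site d → 𝔸ˣ, (∀ x, u₁ x ∈ unitaryUnits 𝔸) → Restr129 L k (Λs k) U₀ u₁ →
      ∀ (v w : Site d → 𝔸ˣ) (lam mu : Site d → 𝔸),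
      (∀ j, j ≤ k → ∀ y ∈ Λs k j, ∀ x : Site d, InBox (tlo L y j) (thi L y j) x →
        ((gaugeExp lam x : 𝔸ˣ) : 𝔸) = ((v x : 𝔸ˣ) : 𝔸) ∧ IsSelfAdjoint (lam x) ∧ ‖lam x‖ < cu ∧
          ∀ κ : Fin d, InBox (tlo L y j) (thi L y j) (x + e κ) → ((L : ℝ) ^ j * η) * ‖covDerivFwd η U₀ κ lam x‖ < cu) →
      (∀ j, j ≤ k → ∀ y ∈ Λs k j, ∀ x : Site d, InBox (tlo L y j) (thi L y j) x →
        ((gaugeExp mu x : 𝔸ˣ) : 𝔸) = ((w x : 𝔸ˣ) : 𝔸) ∧ IsSelfAdjoint (mu x) ∧ ‖mu x‖ < cu ∧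
          ∀ κ : Fin d, InBox (tlo L y j) (thi L y j) (x + e κ) → ((L : ℝ) ^ j * η) * ‖covDerivFwd η U₀ κ mu x‖ < cu) →
      IsLandau138W L k η (Ω 0) (Λs k) U₀ (mgauge U₀ v⁻¹ (mgauge U₀ u₁⁻¹ U')) → Restr129 L k (Λs k) U₀ (u₁ * v) →
      IsLandau138W L k η (Ω 0) (Λs k) U₀ (mgauge U₀ w⁻¹ (mgauge U₀ u₁⁻¹ U')) → Restr129 L k (Λs k) U₀ (u₁ * w) →
      ∀ j, j ≤ k → ∀ y ∈ Λs k j, ∀ x : Site d, InBox (tlo L y j) (thi L y j) x → v x = w x) →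
      ∃ u : Site d → 𝔸ˣ, (∀ x, u x ∈ unitaryUnits 𝔸) ∧ (∀ x, x ∉ Ω 0 → u x = 1) ∧ Restr129 L k (Λs k) U₀ u ∧
        (1 ≤ k → IsLandau138W L k η (Ω 0) (Λs k) U₀ (mgauge U₀ u⁻¹ U')) ∧
        (∀ j, j ≤ k → ∀ b ∈ {b : Site d × Fin d | SideTouches (Ω j) b.1 b.2},
          mgauge U₀ u⁻¹ U' b.1 b.2 = cfgExp η (logCfg η (mgauge U₀ u⁻¹ U')) b.1 b.2 ∧
            IsSelfAdjoint (logCfg η (mgauge U₀ u⁻¹ U') b.1 b.2) ∧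
            ‖logCfg η (mgauge U₀ u⁻¹ U') b.1 b.2‖ ≤ (5 * (d : ℝ) * L * B₀ * (α₀ + α₁)) * ((L : ℝ) ^ j * η)⁻¹) ∧
        ∀ u' : Site d → 𝔸ˣ, (∀ x, u' x ∈ unitaryUnits 𝔸) → (∀ x, x ∉ Ω 0 → u' x = 1) → Restr129 L k (Λs k) U₀ u' →
          IsLandau138W L k η (Ω 0) (Λs k) U₀ (mgauge U₀ u'⁻¹ U') →
          (∃ A' : Site d → Fin d → 𝔸, ∀ j, j ≤ k → ∀ (x : Site d) (κ : Fin d), SideTouches (Ω j) x κ →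
            mgauge U₀ u'⁻¹ U' x κ = cfgExp η A' x κ ∧ ‖A' x κ‖ ≤ (5 * (d : ℝ) * L * B₀ * (α₀ + α₁)) * ((L : ℝ) ^ j * η)⁻¹) →
          (1 ≤ k) → u' = u := by
  have hL1 : 1 ≤ L := le_trans (by norm_num) hL
  have hd1 : 1 ≤ d := le_trans (by norm_num) hd2
  have hd' : (1 : ℝ) ≤ d := by exact_mod_cast hd1
  have hL' : (1 : ℝ) ≤ L := by exact_mod_cast hL1
  obtain ⟨c₁, hc₁, hw⟩ := thm4_windows hd1 hL1 hB₀ hB₀' hB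
  obtain ⟨c₂, hc₂, hw'⟩ := thm4_windows_extra (d := d) hL1
  -- the threshold for Proposition 5's uniqueness radius: `2000·d·c⋆ ≤ cu`
  obtain ⟨c₃, hc₃def⟩ : ∃ c₃ : ℝ, c₃ = cu / (2000 * d * (5 * d * L * B₀)) := ⟨_, rfl⟩
  have hc₃ : 0 < c₃ := by rw [hc₃def]; positivity
  refine ⟨min (min c₁ c₂) c₃, lt_min (lt_min hc₁ hc₂) hc₃, ?_⟩
  intro η hη k Ω hΩ Λs Λb hbox hclass htower hpart α₀ α₁ hα₀ hα₁ hS U₀ U' hU₀ hU' h33 h34 hAx h135 h66 SP5base SP5 SH59 SP5u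
  have hS1 : α₀ + α₁ ≤ c₁ := hS.trans ((min_le_left _ _).trans (min_le_left _ _))
  have hS2 : α₀ + α₁ ≤ c₂ := hS.trans ((min_le_left _ _).trans (min_le_right _ _))
  have hS3 : α₀ + α₁ ≤ c₃ := hS.trans (min_le_right _ _)
  have hS0 : 0 ≤ α₀ + α₁ := by linarith
  obtain ⟨w1, w2, w3, w4, w5, w6, w7, w8, w9, w10, w11, w12, w13, w14, w15, w16, w17, w18⟩ :=
    hw α₀ α₁ hα₀ hα₁ hS1 (5 * (d : ℝ) * L * B₀ * (α₀ + α₁)) (8 * B₀' * (5 * (d : ℝ) * L * B₀) * (α₀ + α₁)) rfl rfl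
  obtain ⟨w19, w20⟩ := hw' α₀ α₁ hα₀ hα₁ hS2
  have hcs0 : 0 ≤ 5 * (d : ℝ) * L * B₀ * (α₀ + α₁) := by positivity
  have hα₄0 : 0 ≤ 8 * B₀' * (5 * (d : ℝ) * L * B₀) * (α₀ + α₁) := by positivity
  -- EXISTENCE (support form) at the top level `k`
  obtain ⟨u, hu, huS, h129, W, hW, hLan, A, hA⟩ := thm4_exists_all_levels_supp_landau138 hd2 hη hL k hU₀ hU' hα₀ hα₁ hα₄0 hB₀.le
    rfl w1 w2 w3 w4 w5 w6 w7 w8 w9 w10 w11 w12 w19 w13 w14 Ω hΩ Λs Λb hbox hclass h33 h34 hAx h135 h66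
    SP5base SP5 SH59 k le_rfl
  have hWeq : W = mgauge U₀ u⁻¹ U' := eq_mgauge_inv_of_mgauge_eq hW
  have hWu : ∀ x κ, W x κ ∈ unitaryUnits 𝔸 := mem_unitaryUnits_of_mgauge_eq hU₀ hU' hu hW
  -- `c⋆ ≤ 1/16` for the logarithm device
  have hc16 : 5 * (d : ℝ) * L * B₀ * (α₀ + α₁) ≤ 1 / 16 := by
    have h₁ : (1 : ℝ) * (5 * (d : ℝ) * L * B₀ * (α₀ + α₁)) ≤ L * (5 * (d : ℝ) * L * B₀ * (α₀ + α₁)) :=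
      mul_le_mul_of_nonneg_right hL' hcs0
    linarith
  -- the exponent read back as `logCfg`
  have hleaf : ∀ j, j ≤ k → ∀ b ∈ {b : Site d × Fin d | SideTouches (Ω j) b.1 b.2},
      mgauge U₀ u⁻¹ U' b.1 b.2 = cfgExp η (logCfg η (mgauge U₀ u⁻¹ U')) b.1 b.2 ∧
        IsSelfAdjoint (logCfg η (mgauge U₀ u⁻¹ U') b.1 b.2) ∧
        ‖logCfg η (mgauge U₀ u⁻¹ U') b.1 b.2‖ ≤ (5 * (d : ℝ) * L * B₀ * (α₀ + α₁)) * ((L : ℝ) ^ j * η)⁻¹ := by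
    intro j hj b hb
    obtain ⟨hexp, -, hbd⟩ := hA j hj b hb
    have hbd' : ‖A b.1 b.2‖ ≤ (5 * (d : ℝ) * L * B₀ * (α₀ + α₁)) * η⁻¹ := by
      refine hbd.trans ?_
      have hLj : (1 : ℝ) ≤ (L : ℝ) ^ j := one_le_pow₀ hL'
      have : ((L : ℝ) ^ j * η)⁻¹ ≤ η⁻¹ := by
        rw [mul_inv]
        calc ((L : ℝ) ^ j)⁻¹ * η⁻¹ ≤ 1 * η⁻¹ := by gcongr; exact inv_le_one_of_one_le₀ hLj
          _ = η⁻¹ := one_mul _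
      exact mul_le_mul_of_nonneg_left this hcs0
    obtain ⟨hlogA, hsa, hWexp⟩ := logField_spec hη U₀ hWu hexp hbd' hc16
    rw [← hWeq]
    refine ⟨hWexp, ?_, ?_⟩
    · simpa [logCfg] using hsa
    · show ‖logCfg η W b.1 b.2‖ ≤ _
      rw [logCfg, hlogA]
      exact hbd
  refine ⟨u, hu, huS, h129, fun hk => hWeq ▸ hLan hk, hleaf, ?_⟩
  -- UNIQUENESS: any other restricted u′ with (1.38) and the (1.62)-shape equals u
  intro u' hu' hu'S h129' hLan' h162' hk1
  have hk_Lan : IsLandau138W L k η (Ω 0) (Λs k) U₀ (mgauge U₀ u⁻¹ U') := hWeq ▸ hLan hk1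
  have h162 : ∃ A₂ : Site d → Fin d → 𝔸, ∀ j, j ≤ k → ∀ (x : Site d) (κ : Fin d), SideTouches (Ω j) x κ →
      mgauge U₀ u⁻¹ U' x κ = cfgExp η A₂ x κ ∧ ‖A₂ x κ‖ ≤ (5 * (d : ℝ) * L * B₀ * (α₀ + α₁)) * ((L : ℝ) ^ j * η)⁻¹ := by
    refine ⟨A, fun j hj x κ hxκ => ?_⟩
    obtain ⟨hexp, -, hbd⟩ := hA j hj (x, κ) hxκ
    rw [← hWeq]
    exact ⟨hexp, hbd⟩
  -- the windows of the uniqueness clause at `c := c⋆`, `α_P := α₀`, and Prop. 5's radius `cu`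
  obtain ⟨cs, hcsdef⟩ : ∃ cs : ℝ, cs = 5 * (d : ℝ) * L * B₀ * (α₀ + α₁) := ⟨_, rfl⟩
  have hcs0' : 0 ≤ cs := by rw [hcsdef]; positivity
  have h2000 : 2000 * (d : ℝ) * cs ≤ cu := by
    have hden : 0 < 2000 * (d : ℝ) * (5 * d * L * B₀) := by positivity
    have h := (le_div_iff₀ hden).1 (hS3.trans (le_of_eq hc₃def))
    have e : 2000 * (d : ℝ) * cs = (α₀ + α₁) * (2000 * d * (5 * d * L * B₀)) := by rw [hcsdef]; ring
    linarith
  have hcu₂ : 5 * cs < cu := by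
    have h₁ : (1 : ℝ) * cs ≤ d * cs := mul_le_mul_of_nonneg_right hd' hcs0'
    have hdcs : 0 ≤ (d : ℝ) * cs := by positivity
    linarith
  have hcu₁ : 2 * (2 * (40 * d * cs) + 2 * 1116 * (40 * d * cs) ^ 2) < cu := by
    have hx0 : 0 ≤ 40 * d * cs := by positivity
    have hx1 : 40 * d * cs ≤ 1 / 5000 := by rw [hcsdef]; exact w16
    have hsq : (40 * d * cs) ^ 2 ≤ 40 * d * cs * (1 / 5000) := by rw [sq]; exact mul_le_mul_of_nonneg_left hx1 hx0
    have hdcs : 0 ≤ (d : ℝ) * cs := by positivity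
    linarith
  rw [hcsdef] at hcu₁ hcu₂
  exact thm4_unique_eq_landau138 hd2 hL hη hU₀ hU' hu' hu hα₀ w5 w6 hcs0 w18 w17 w15 w16 hα₀ w5 w20 hcu₁ hcu₂ h33
    (by rw [← mulCfg_eq_mul]; exact h34) (by rw [← mulCfg_eq_mul]; exact hAx k le_rfl) htower h129' h129 hLan' hk_Lan h162' h162
    (SP5u u' hu' h129') hpart hu'S huS


#print axioms thm4Body_concrete_at

end Literature.MathematicalPhysics.QuantumFieldTheory.Balaban1983to89.B8Thm4ConcreteAt

end
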